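import Summits.QuantumFields.YangMills.Theorems.SwapVirialDeficitNearlyCommutingThreeCeiling
import HarnessLib

/-!
# Exact zero-mode rung on the GROUP, three letters — I: the commutator Laplace block on `SU(2)³` in the ball (cone) model
# (rung Z4 in Laplace form: `β²·∫_{SU(2)³} e^{−β(‖[q₀,q₁]‖² + ‖[q₀,q₂]‖² + ‖[q₁,q₂]‖²)} dHaar³ → v₃`; LEAD ym-line-sfw-p2 g93 07:46Z «the zero-mode inputs a
# sharp law needs next are EXACT asymptotics»; fcl-p3 g43's Z1–Z5 plan; free-hands support of ⟨stmt-QuantumFields-24197⟩)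

The compact-group twin of w3 g62's ✓`ZeroMode.tendsto_zeroModeZ_three` (Gaussian model).  This first file moves the three-letter block
`Λ₃(β) = ∫_{SU(2)³} exp(−β·Σ_{μ<ν}‖q_μq_ν − q_νq_μ‖²) dHaar³` (`q_μ = su2Quat (C μ)`) to the CONE MODEL: Haar on `SU(2)` is the radial image of the
normalised Lebesgue measure of the unit ball of `ℍ` (✓`ToronLog.measurePreserving_quatToSU2`), and for non-zero `x, y ∈ ℍ`
`‖q(x̂)q(ŷ) − q(ŷ)q(x̂)‖² = ‖xy − yx‖²/(‖x‖²‖y‖²) =: commSq x y` (✓`su2Quat_quatToSU2`, ✓`norm_comm_smul`).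
* §1 `commSq`, `blockThree` (the block as a function of three quaternions), `laplaceThree` (the block integral), `psiCone` (the inner pair integral);
* §2 ★ `ofReal_laplaceThree_eq_lintegral_cone` — `Λ₃(β) = ∫ e^{−β·blockThree} d(cone³)`;
* §3 ★ `ofReal_laplaceThree_eq_lintegral_psiCone` — Tonelli with the THIRD letter as hub: `Λ₃(β) = ∫ ψ_β(a) dcone(a)`,
  `ψ_β(a) = ∫∫ e^{−β·blockThree x y a} dcone(x) dcone(y)`.
Parts II–III: the hub is straightened onto the `I`-axis by conjugation, the `(J,K)`-components of the two other letters are rescaled by `β^{−1/2}`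
(Jacobian `β⁻²`), and dominated convergence with the β-free Gaussian dominator `exp(−4[r²(|w₁|²+|w₂|²) + |z₁w₂ − z₂w₁|²])` gives the limit — the
dominator's integral `∝ ∫ dr dz₁ dz₂/(r² + z₁² + z₂²) < ∞` is the no-log mechanism on the group.
HONEST LABEL: finite-dimensional measure theory on `SU(2)³` (plan-level zero-mode rung); NOT the fixed-`L` sharp law of `F^S`, NOT ⟨24197⟩; the Yang–Mills
mass gap is NOT proved; no summit is proved by a line.  Width seat ym-line-sfw-p2-w2 g55 (cell ym-idea-1, free hands; own crux ⟨22884⟩ blocked-on ⟨19935⟩),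
`--supports stmt-QuantumFields-24197`.  Standard axioms, 0 `sorry`.  References: [cite: GonzalezarroyoAltes1988]; [cite: Vanbaal2001]; [folklore].
-/

set_option autoImplicit false

noncomputable section

open MeasureTheory Quaternion Set
open scoped Quaternion ENNReal BigOperators
open Literature.MathematicalPhysics.QuantumLattice
open Literature.MathematicalPhysics.QuantumFieldTheory (haarProbability)
open Literature.MathematicalPhysics.QuantumFieldTheory.Balaban1983to89.T4HaarSU2Translate (su2Quat_quatToSU2 measurable_su2Quat)
open Summit.QuantumFields.YangMills.Theorems.SwapTwistDeficit.ToronLog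

attribute [local instance] Literature.Analysis.FluidPDE.Tao2016.quatMeasurableSpace
  Literature.Analysis.FluidPDE.Tao2016.quatBorelSpace
  Literature.MathematicalPhysics.QuantumLattice.secondCountableTopology_su2

namespace Summit.QuantumFields.YangMills.Theorems.SwapVirialDeficit.ZeroModeGroup

/-! ## §1 The block in the cone model -/

/-- The squared commutator of the NORMALISED letters, as a function of two quaternions: `‖xy − yx‖²/(‖x‖²‖y‖²)` (junk `0` at `x = 0` or `y = 0`).
[folklore] -/
def commSq (x y : ℍ) : ℝ := ‖x * y - y * x‖ ^ 2 / (‖x‖ ^ 2 * ‖y‖ ^ 2)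

/-- The three-letter block `commSq x y + commSq x a + commSq y a` (the third letter `a` is the hub of parts II–III). [folklore] -/
def blockThree (x y a : ℍ) : ℝ := commSq x y + commSq x a + commSq y a

/-- ★ **The three-letter commutator Laplace block** `Λ₃(β) = ∫_{SU(2)³} exp(−β·(‖[q₀,q₁]‖² + ‖[q₀,q₂]‖² + ‖[q₁,q₂]‖²)) dHaar³`, `q_μ = su2Quat (C μ)`.
[cite: GonzalezarroyoAltes1988] [cite: Vanbaal2001] -/
def laplaceThree (β : ℝ) : ℝ :=
  ∫ C : Fin 3 → (Matrix.specialUnitaryGroup (Fin 2) ℂ), Real.exp (-(β * (‖su2Quat (C 0) * su2Quat (C 1) - su2Quat (C 1) * su2Quat (C 0)‖ ^ 2 +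
      ‖su2Quat (C 0) * su2Quat (C 2) - su2Quat (C 2) * su2Quat (C 0)‖ ^ 2 +
      ‖su2Quat (C 1) * su2Quat (C 2) - su2Quat (C 2) * su2Quat (C 1)‖ ^ 2)))
    ∂(Measure.pi fun _ : Fin 3 => haarProbability (Matrix.specialUnitaryGroup (Fin 2) ℂ))

/-- The inner pair integral of the cone model at hub `a`: `ψ_β(a) = ∫∫ e^{−β·blockThree x y a} dcone(x) dcone(y)`. [folklore] -/
def psiCone (β : ℝ) (a : ℍ) : ℝ≥0∞ :=
  ∫⁻ p : ℍ × ℍ, ENNReal.ofReal (Real.exp (-(β * blockThree p.1 p.2 a))) ∂(coneMeasure.prod coneMeasure)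

/-- Unfolding `commSq` (the definition is made irreducible below, for fast elaboration). [folklore] -/
theorem commSq_def (x y : ℍ) : commSq x y = ‖x * y - y * x‖ ^ 2 / (‖x‖ ^ 2 * ‖y‖ ^ 2) := rfl

/-- Unfolding `blockThree`. [folklore] -/
theorem blockThree_def (x y a : ℍ) : blockThree x y a = commSq x y + commSq x a + commSq y a := rfl

/-- Unfolding `psiCone`. [folklore] -/
theorem psiCone_def (β : ℝ) (a : ℍ) :
    psiCone β a = ∫⁻ p : ℍ × ℍ, ENNReal.ofReal (Real.exp (-(β * blockThree p.1 p.2 a))) ∂(coneMeasure.prod coneMeasure) := rfl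

/-- `commSq ≥ 0`. [folklore] -/
theorem commSq_nonneg (x y : ℍ) : 0 ≤ commSq x y := by unfold commSq; positivity

/-- `blockThree ≥ 0`. [folklore] -/
theorem blockThree_nonneg (x y a : ℍ) : 0 ≤ blockThree x y a := by
  unfold blockThree; have := commSq_nonneg x y; have := commSq_nonneg x a; have := commSq_nonneg y a; linarith

/-- `commSq` is symmetric. [folklore] -/
theorem commSq_comm (x y : ℍ) : commSq x y = commSq y x := by
  unfold commSq; rw [norm_sub_rev, mul_comm (‖x‖ ^ 2)]

/-- ★ **Normalised letters**: for non-zero `x, y`, `‖q(x̂)q(ŷ) − q(ŷ)q(x̂)‖² = commSq x y` (`q(x̂) = x/‖x‖`, ✓`su2Quat_quatToSU2`). [folklore] -/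
theorem norm_comm_su2Quat_quatToSU2_sq {x y : ℍ} (hx : x ≠ 0) (hy : y ≠ 0) :
    ‖su2Quat (quatToSU2 x) * su2Quat (quatToSU2 y) - su2Quat (quatToSU2 y) * su2Quat (quatToSU2 x)‖ ^ 2 = commSq x y := by
  rw [su2Quat_quatToSU2 hx, su2Quat_quatToSU2 hy, norm_comm_smul, abs_of_nonneg (inv_nonneg.2 (norm_nonneg _)),
    abs_of_nonneg (inv_nonneg.2 (norm_nonneg _)), commSq]
  have hx' : ‖x‖ ≠ 0 := norm_ne_zero_iff.2 hx
  have hy' : ‖y‖ ≠ 0 := norm_ne_zero_iff.2 hy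
  field_simp

/-- The junk value: `commSq 0 y = 0`. [folklore] -/
theorem commSq_zero_left (y : ℍ) : commSq 0 y = 0 := by simp [commSq]

/-- The explicit quotient defining `commSq` is measurable. [folklore] -/
theorem measurable_commSq_expr :
    Measurable fun p : ℍ × ℍ => ‖p.1 * p.2 - p.2 * p.1‖ ^ 2 / (‖p.1‖ ^ 2 * ‖p.2‖ ^ 2) := by
  have h1 : Measurable fun p : ℍ × ℍ => ‖p.1 * p.2 - p.2 * p.1‖ ^ 2 := by
    have : Continuous fun p : ℍ × ℍ => ‖p.1 * p.2 - p.2 * p.1‖ ^ 2 := by fun_prop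
    exact this.measurable
  have h2 : Measurable fun p : ℍ × ℍ => ‖p.1‖ ^ 2 * ‖p.2‖ ^ 2 := by
    have : Continuous fun p : ℍ × ℍ => ‖p.1‖ ^ 2 * ‖p.2‖ ^ 2 := by fun_prop
    exact this.measurable
  exact h1.div h2

/-- `commSq` is measurable on `ℍ × ℍ`. [folklore] -/
theorem measurable_commSq : Measurable fun p : ℍ × ℍ => commSq p.1 p.2 :=
  measurable_commSq_expr

attribute [irreducible] commSq

/-- `blockThree` is measurable on `ℍ × ℍ × ℍ` (arguments `(x, y, a)`). [folklore] -/
theorem measurable_blockThree : Measurable fun p : ℍ × ℍ × ℍ => blockThree p.1 p.2.1 p.2.2 := by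
  unfold blockThree
  have h1 : Measurable fun p : ℍ × ℍ × ℍ => commSq p.1 p.2.1 :=
    measurable_commSq.comp (measurable_fst.prodMk (measurable_fst.comp measurable_snd))
  have h2 : Measurable fun p : ℍ × ℍ × ℍ => commSq p.1 p.2.2 :=
    measurable_commSq.comp (measurable_fst.prodMk (measurable_snd.comp measurable_snd))
  have h3 : Measurable fun p : ℍ × ℍ × ℍ => commSq p.2.1 p.2.2 :=
    measurable_commSq.comp ((measurable_fst.comp measurable_snd).prodMk (measurable_snd.comp measurable_snd))
  exact (h1.add h2).add h3

/-- The cone-model integrand is measurable. [folklore] -/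
theorem measurable_expBlock (β : ℝ) : Measurable fun p : ℍ × ℍ × ℍ => ENNReal.ofReal (Real.exp (-(β * blockThree p.1 p.2.1 p.2.2))) :=
  ENNReal.measurable_ofReal.comp (Real.measurable_exp.comp (measurable_const.mul measurable_blockThree).neg)

attribute [irreducible] blockThree

/-! ## §2 Haar³ to cone³ -/

/-- The cone measure has no atom at `0`. [folklore] -/
theorem coneMeasure_singleton_zero : coneMeasure ({0} : Set ℍ) = 0 := by
  rw [coneMeasure, Measure.smul_apply, smul_eq_mul]
  have h : (volume : Measure ℍ).restrict (Metric.ball 0 1) {0} = 0 :=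
    le_antisymm ((Measure.restrict_apply_le _ _).trans (le_of_eq (measure_singleton _))) bot_le
  rw [h, mul_zero]

/-- Almost every point of the product cone measure has all three letters non-zero. [folklore] -/
theorem ae_ne_zero_pi_three : ∀ᵐ x : Fin 3 → ℍ ∂(Measure.pi fun _ : Fin 3 => coneMeasure), ∀ μ : Fin 3, x μ ≠ 0 := by
  haveI := isProbabilityMeasure_coneMeasure
  have h : ∀ μ : Fin 3, ∀ᵐ x : Fin 3 → ℍ ∂(Measure.pi fun _ : Fin 3 => coneMeasure), x μ ≠ 0 := by
    intro μ
    have h0 : (Measure.pi fun _ : Fin 3 => coneMeasure) (Function.eval μ ⁻¹' ({0} : Set ℍ)) = 0 :=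
      Measure.pi_eval_preimage_null _ coneMeasure_singleton_zero
    rw [ae_iff]
    refine measure_mono_null (fun x hx => ?_) h0
    simp only [ne_eq, not_not, Set.mem_setOf_eq] at hx
    exact hx
  rw [ae_all_iff]
  exact h

/-- ★ **`Λ₃(β)` in the cone model**: `Λ₃(β) = ∫ e^{−β·blockThree(x₀,x₁,x₂)} dcone³(x)` for `β ≥ 0`. [folklore] -/
theorem ofReal_laplaceThree_eq_lintegral_cone {β : ℝ} (hβ : 0 ≤ β) :
    ENNReal.ofReal (laplaceThree β) =
      ∫⁻ x : Fin 3 → ℍ, ENNReal.ofReal (Real.exp (-(β * blockThree (x 0) (x 1) (x 2)))) ∂(Measure.pi fun _ : Fin 3 => coneMeasure) := by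
  haveI := isProbabilityMeasure_coneMeasure
  -- the group-side integrand
  set g : (Fin 3 → (Matrix.specialUnitaryGroup (Fin 2) ℂ)) → ℝ := fun C => Real.exp (-(β * (‖su2Quat (C 0) * su2Quat (C 1) - su2Quat (C 1) * su2Quat (C 0)‖ ^ 2 +
      ‖su2Quat (C 0) * su2Quat (C 2) - su2Quat (C 2) * su2Quat (C 0)‖ ^ 2 +
      ‖su2Quat (C 1) * su2Quat (C 2) - su2Quat (C 2) * su2Quat (C 1)‖ ^ 2))) with hg
  have hq : ∀ μ : Fin 3, Measurable fun C : Fin 3 → (Matrix.specialUnitaryGroup (Fin 2) ℂ) => su2Quat (C μ) := fun μ => measurable_su2Quat.comp (measurable_pi_apply μ)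
  have hS : Measurable fun C : Fin 3 → (Matrix.specialUnitaryGroup (Fin 2) ℂ) => ‖su2Quat (C 0) * su2Quat (C 1) - su2Quat (C 1) * su2Quat (C 0)‖ ^ 2 +
      ‖su2Quat (C 0) * su2Quat (C 2) - su2Quat (C 2) * su2Quat (C 0)‖ ^ 2 +
      ‖su2Quat (C 1) * su2Quat (C 2) - su2Quat (C 2) * su2Quat (C 1)‖ ^ 2 :=
    (((((hq 0).mul (hq 1)).sub ((hq 1).mul (hq 0))).norm.pow_const 2).add
      ((((hq 0).mul (hq 2)).sub ((hq 2).mul (hq 0))).norm.pow_const 2)).add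
      ((((hq 1).mul (hq 2)).sub ((hq 2).mul (hq 1))).norm.pow_const 2)
  have hgm : Measurable g := Real.measurable_exp.comp (measurable_const.mul hS).neg
  have hg0 : ∀ C, 0 ≤ g C := fun C => (Real.exp_pos _).le
  have hg1 : ∀ C, g C ≤ 1 := by
    intro C; rw [hg]; refine Real.exp_le_one_iff.2 (neg_nonpos.2 (mul_nonneg hβ (by positivity)))
  have hint : Integrable g (Measure.pi fun _ : Fin 3 => haarProbability (Matrix.specialUnitaryGroup (Fin 2) ℂ)) :=
    (integrable_const (1 : ℝ)).mono' hgm.aestronglyMeasurable (ae_of_all _ fun C => by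
      rw [Real.norm_eq_abs, abs_of_nonneg (hg0 C)]; exact hg1 C)
  have h1 : ENNReal.ofReal (laplaceThree β) = ∫⁻ C, ENNReal.ofReal (g C) ∂(Measure.pi fun _ : Fin 3 => haarProbability (Matrix.specialUnitaryGroup (Fin 2) ℂ)) := by
    unfold laplaceThree
    exact ofReal_integral_eq_lintegral_ofReal hint (ae_of_all _ hg0)
  have h2 := NearlyCommutingThree.measurePreserving_proj_three.lintegral_comp (f := fun C => ENNReal.ofReal (g C)) (ENNReal.measurable_ofReal.comp hgm)
  rw [h1, ← h2]
  refine lintegral_congr_ae ?_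
  filter_upwards [ae_ne_zero_pi_three] with x hx
  simp only [hg]
  rw [norm_comm_su2Quat_quatToSU2_sq (hx 0) (hx 1), norm_comm_su2Quat_quatToSU2_sq (hx 0) (hx 2),
    norm_comm_su2Quat_quatToSU2_sq (hx 1) (hx 2), blockThree]

/-! ## §3 Tonelli: the third letter as hub -/

/-- Splitting off the hub letter: `∫ G(x₀,x₁,x₂) dcone³ = ∫ (∫∫ G(x,y,a) dcone(x)dcone(y)) dcone(a)`. [folklore] -/
theorem lintegral_pi_three_eq_hub (G : ℍ × ℍ × ℍ → ℝ≥0∞) (hG : Measurable G) :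
    ∫⁻ x : Fin 3 → ℍ, G (x 0, x 1, x 2) ∂(Measure.pi fun _ : Fin 3 => coneMeasure) =
      ∫⁻ a, ∫⁻ p : ℍ × ℍ, G (p.1, p.2, a) ∂(coneMeasure.prod coneMeasure) ∂coneMeasure := by
  haveI := isProbabilityMeasure_coneMeasure
  -- split off coordinate `2 = Fin.last 2`
  have hp := (measurePreserving_piFinSuccAbove (fun _ : Fin 3 => coneMeasure) (Fin.last 2)).symm
  have hF : Measurable fun x : Fin 3 → ℍ => G (x 0, x 1, x 2) :=
    hG.comp ((measurable_pi_apply 0).prodMk ((measurable_pi_apply 1).prodMk (measurable_pi_apply 2)))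
  rw [← hp.lintegral_comp hF]
  have hsymm : ∀ q : ℍ × (Fin 2 → ℍ),
      (MeasurableEquiv.piFinSuccAbove (fun _ : Fin 3 => ℍ) (Fin.last 2)).symm q = Fin.snoc q.2 q.1 := by
    intro q
    rw [MeasurableEquiv.piFinSuccAbove_symm_apply]
    exact Fin.insertNth_last' q.1 q.2
  have h0 : ∀ (y : Fin 2 → ℍ) (a : ℍ), (Fin.snoc y a : Fin 3 → ℍ) 0 = y 0 := fun y a => Fin.snoc_castSucc (α := fun _ => ℍ) a y 0
  have h1 : ∀ (y : Fin 2 → ℍ) (a : ℍ), (Fin.snoc y a : Fin 3 → ℍ) 1 = y 1 := fun y a => Fin.snoc_castSucc (α := fun _ => ℍ) a y 1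
  have h2 : ∀ (y : Fin 2 → ℍ) (a : ℍ), (Fin.snoc y a : Fin 3 → ℍ) 2 = a := fun y a => Fin.snoc_last (α := fun _ => ℍ) a y
  simp only [hsymm, h0, h1, h2]
  -- Tonelli over `coneMeasure.prod (pi Fin 2)`
  have hG2 : Measurable fun q : ℍ × (Fin 2 → ℍ) => G (q.2 0, q.2 1, q.1) :=
    hG.comp (((measurable_pi_apply 0).comp measurable_snd).prodMk
      (((measurable_pi_apply 1).comp measurable_snd).prodMk measurable_fst))
  rw [lintegral_prod _ hG2.aemeasurable]
  refine lintegral_congr fun a => ?_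
  -- the inner `Fin 2 → ℍ` integral as an `ℍ × ℍ` integral
  have h2A := measurePreserving_finTwoArrow (coneMeasure)
  have hGa : Measurable fun p : ℍ × ℍ => G (p.1, p.2, a) := hG.comp (measurable_fst.prodMk (measurable_snd.prodMk measurable_const))
  rw [← h2A.lintegral_comp hGa]
  rfl

/-- ★ **`Λ₃(β) = ∫ ψ_β(a) dcone(a)`** — the third letter as hub. [folklore] -/
theorem ofReal_laplaceThree_eq_lintegral_psiCone {β : ℝ} (hβ : 0 ≤ β) :
    ENNReal.ofReal (laplaceThree β) = ∫⁻ a, psiCone β a ∂coneMeasure := by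
  rw [ofReal_laplaceThree_eq_lintegral_cone hβ]
  exact lintegral_pi_three_eq_hub _ (measurable_expBlock β)

/-- `ψ_β(a) ≤ 1` (probability measures, integrand `≤ 1` for `β ≥ 0`). [folklore] -/
theorem psiCone_le_one {β : ℝ} (hβ : 0 ≤ β) (a : ℍ) : psiCone β a ≤ 1 := by
  haveI := isProbabilityMeasure_coneMeasure
  unfold psiCone
  calc ∫⁻ p : ℍ × ℍ, ENNReal.ofReal (Real.exp (-(β * blockThree p.1 p.2 a))) ∂(coneMeasure.prod coneMeasure)
      ≤ ∫⁻ _p : ℍ × ℍ, 1 ∂(coneMeasure.prod coneMeasure) :=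
        lintegral_mono fun p => ENNReal.ofReal_le_one.2 (Real.exp_le_one_iff.2
          (neg_nonpos.2 (mul_nonneg hβ (blockThree_nonneg _ _ _))))
    _ = 1 := by rw [lintegral_const, one_mul, measure_univ]

/-- `ψ_β` is measurable in the hub. [folklore] -/
theorem measurable_psiCone (β : ℝ) : Measurable (psiCone β) := by
  haveI := isProbabilityMeasure_coneMeasure
  have hf : Measurable fun q : (ℍ × ℍ) × ℍ => ENNReal.ofReal (Real.exp (-(β * blockThree q.1.1 q.1.2 q.2))) :=
    (measurable_expBlock β).comp ((measurable_fst.comp measurable_fst).prodMk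
      ((measurable_snd.comp measurable_fst).prodMk measurable_snd))
  unfold psiCone
  exact hf.lintegral_prod_left'

end Summit.QuantumFields.YangMills.Theorems.SwapVirialDeficit.ZeroModeGroup

end
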